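import Summits.HodgeConjecture.HodgeConjecture.Theorems.F0P3SpectralPacketTraceFactorisation  -- ★ (N) FILE 2c p841950 (F0P2-p01 (g9)): (TF-Π) `TraceOnPureTensors`, (TF-1) `UnramTraceOne`, `eq_prod_of_subset` (+ ★ FILE 3a `SpectralPacketG`, FILE 2b `ramFinset`, ★ `PureTensor`, `TestG`)
import HarnessLib

/-!
# (N) DEFS, FILE 3d — THE PACKET TRACE `Tr Π(f)` AS A TOTAL FUNCTIONAL ON `TestG L = C_c(G(𝔸))`: `SpectralPacketG.tr Q νG archTr` (product form on the smooth pure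
# tensors presented at the integral levels, junk `0` elsewhere) and its ONE residual law (TF-ind) `PresentationIndep` (Rogawski §13.3 p. 201 first display, l. 1–4; §14.2 p. 233)

Cell `hodgecm-mathlib` (D-0151), F0∕P3 «U3-mult», crux H413 (`stmt-HodgeConjecture-24833`), route of record `HCCMUnconditional`.  LEAD F0P3a-plan (g9) WORD T8-141 (1)
«=» (a) «(N) DEFS FILE 3d `trG` TOTAL on `TestG L`», census-first: `F0/P3a/F0P3a-p01/g12/CENSUS-N-FILE3d-trG-total.F0P3a-p01g12.md` 7123930d (F0P3a-p01 (g12), (N) lead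
pen).  VERDICT V1 of that census (the LEAD's question «is (T)-totality genuinely needed?»): NO — clause (T) of the spectral letter `K9SpectralLetter` (closer companion
`Lines/F0_U3LettersRung1Defs.lean`) reads `trG Q f` only at MATCHED `f` (`𝔨.Matches f′ f fH`) of a PINNED kit, and pin (ix′) of `ComparisonKit.IsPinned` (projection
`IsPinned.transfer_tensors`) makes every such `f` a SMOOTH PURE TENSOR `⇑f = T′.eval` (★ `UnitaryGroup.PureTensor`, `T′.IsTest`); there print's `Tr Π(f)` is the PRODUCT
`Tr Π_∞(f_∞) · ∏_v Tr Π_v(f_v)` [Rogawski1990 §13.3 p. 201, first display] — Rogawski evaluates the stable trace formula only at `f = ⊗ f_v` [§14.2 p. 233; (14.6.1)].  So the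
tuple's `trG` is DEFINED here (no longer a parameter of FILE 3) as that product on the smooth pure tensors and `0` elsewhere; «TF at packet members» (p. 201 second display) is
off the critical path.  Definition lane (four `def`s: two `Prop`-predicates + two functionals) + `rfl`∕`dif`∕one-line read-backs; namespace of ★ FILE 3a
(`…Cruxes.H413.F0P3SpectralPacket.SpectralPacketG`); `H′ := splitForm L 3` throughout (the carrier of `TestG L`, as ★ FILE 2c); box-before-file (B-typ03∕B-typ04);
`--supports stmt-HodgeConjecture-24833 --as helper`.  No instance, no notation, no named fact, no `sorry`; no `Classical` instance in any STATEMENT (the choice lives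
inside the body of `tr` only).
HONEST LABEL: HC_CM is proved only modulo the printed citations until rung 0 closes; this file proves no printed statement — it DEFINES the functional the letters
STF-T∕PK-F are typed against and names the bookkeeping fact print calls «well-defined» (p. 201 l. 1–4) as the law (TF-ind).

CONTENTS.
* §1 (d1) `SpectralPacketG.IsTestPresentation Q F T` — «`T` is a smooth pure tensor at the integral levels, with bad set `⊇ Π.ramFinset`, presenting `F`» (= the four
  antecedents of ★ (TF-Π) `TraceOnPureTensors`, bundled); (d2) `SpectralPacketG.trTensor Q νG archTr T := Tr Π_∞(T.arch) · ∏_{v ∈ T.S} Tr Π_v(T.loc v)` (= (TF-Π)'s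
  right-hand side: ★ FILE 1b `trPktInf` × ★ FILE 1 `trPkt`); (d3) **`SpectralPacketG.tr Q νG archTr : TestG L → ℂ`** — THE TUPLE'S `trG Q`: `trTensor` of SOME test
  presentation if one exists, `0` otherwise; (d4) the law **(TF-ind) `SpectralPacketG.PresentationIndep Q νG archTr`** — two test presentations of one function have the
  same `trTensor` [p. 201 l. 1–4 «the products are well-defined»; in-house: scalar rigidity of pure-tensor presentations + homogeneity of admissible characters — the
  next brick, not here].
* §2 read-backs: `isTestPresentation_iff`, `trTensor_eq`, `tr_of_not` (junk clause), `tr_eq_trTensor (hind)`, **`traceOnPureTensors_tr (hind) : Q.TraceOnPureTensors νG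
  archTr (Q.tr νG archTr)`** (★ FILE 2c's law (TF-Π) DISCHARGED for the defined functional, modulo (TF-ind)), `tr_eq_prod_of_subset` (any larger finite set, under
  ★ (TF-1) `UnramTraceOne`).
* §3 «EVERY smooth pure tensor has a test presentation»: `PureTensor.eval_ofUnramified_of_isUnramified` (re-presenting a tensor at the integral levels with a larger bad
  set does not change the function), `exists_isTestPresentation (hT : T.IsTest) (hF : ⇑F = T.eval)`, and the consumer form **`tr_eq_of_isTest (hind) (hT) (hF) (hS :
  T.S ∪ … ⊆ S′)`**: at a matched `f` of a pinned kit (`IsPinned.transfer_tensors`) the functional IS the product over any finite `S′ ⊇ T.S ∪ Π.ramFinset` — never junk there.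

References: [Rogawski1990] §13.3 p. 201 (first display, l. 1–4), §13.7 p. 206, §14.2 p. 233, §14.6 (14.6.1) p. 241; [FlathCorvallis1979] Thm. 3; [BorelJacquet1979] §4.1.
-/

set_option autoImplicit false
-- the mandated namespace repeats `HodgeConjecture.HodgeConjecture`, as in every `Theorems/*.lean` of this sub-problem
set_option linter.dupNamespace false

noncomputable section

open NumberField IsDedekindDomain MeasureTheory
open scoped Matrix MatrixGroups

open Literature.NumberTheory Literature.NumberTheory.Automorphic Literature.NumberTheory.Automorphic.UnitaryGroup
open Literature.NumberTheory.Rogawski1990 Literature.NumberTheory.GaloisRepresentations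
open Literature.RepresentationTheory.BorelWallach2000 Literature.RepresentationTheory.KonnoKonno2007
open Summit.HodgeConjecture.HodgeConjecture.Cruxes.H413.F0P3InnerFormClassificationV6 (TestG splitForm)
open Summit.HodgeConjecture.HodgeConjecture.Cruxes.H413.F0P3LocalPacketKit
open Summit.HodgeConjecture.HodgeConjecture.Cruxes.H413.F0P3ArchPacketKit

/-! ## §3a A pure-tensor lemma: re-presenting at the integral levels with a larger bad set [§14.2 p. 233] (generic `N`, `H`; in ★ `PureTensor`'s namespace) -/

namespace Literature.NumberTheory.Automorphic.UnitaryGroup.PureTensor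

variable {L : Type} [Field L] [NumberField L] [IsCMField L] {N : ℕ} {H : Matrix (Fin N) (Fin N) L}

/-- **An UNRAMIFIED pure tensor re-presented at the integral levels with any larger bad set is the same function**: for `T.IsUnramified` and `T.S ⊆ S′`,
`(ofUnramified S′ T.loc T.arch).eval = T.eval` (on `S′ ∖ T.S` the new factor `T.loc v = 1_{U(H)(𝒪_v)}` is `1` exactly on the level condition `T` imposes; on `T.S` the
levels play no role in `eval`). [cite: Rogawski1990, §14.2 p. 233] [cite: BorelJacquet1979, §4.1] -/
theorem eval_ofUnramified_of_isUnramified (T : PureTensor L N H) (hT : T.IsUnramified)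
    (S' : Finset (HeightOneSpectrum (𝓞 ↥(maximalRealSubfield L)))) (hS : T.S ⊆ S') :
    (ofUnramified L N H S' T.loc T.arch).eval = T.eval := by
  classical
  have hloc : ∀ v, (ofUnramified L N H S' T.loc T.arch).loc v = T.loc v := fun v => by
    by_cases hv : v ∈ S'
    · exact ofUnramified_loc_of_mem T.loc T.arch hv
    · rw [(ofUnramified L N H S' T.loc T.arch).loc_eq_indicator v (by rwa [ofUnramified_S]),
        T.loc_eq_indicator v (fun h => hv (hS h)), hT.K_eq (fun h => hv (hS h))]
      rfl
  funext g
  by_cases h' : ∀ v ∉ S', (cmDatum L N H).toLocal v g ∈ (ofUnramified L N H S' T.loc T.arch).K v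
  · by_cases h : ∀ v ∉ T.S, (cmDatum L N H).toLocal v g ∈ T.K v
    · rw [T.eval_eq_of_forall_mem g h, (ofUnramified L N H S' T.loc T.arch).eval_eq_of_forall_mem g (by simpa only [ofUnramified_S] using h'),
        ofUnramified_S, ← Finset.prod_sdiff hS]
      have h1 : ∏ v ∈ S' \ T.S, (ofUnramified L N H S' T.loc T.arch).loc v ((cmDatum L N H).toLocal v g) = 1 := by
        refine Finset.prod_eq_one fun v hv => ?_
        rw [Finset.mem_sdiff] at hv
        rw [hloc v]
        exact T.loc_apply_of_mem hv.2 (h v hv.2)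
      rw [h1, one_mul]
      exact congrArg _ (Finset.prod_congr rfl fun v _ => by rw [hloc v])
    · push Not at h
      obtain ⟨v, hv, hgv⟩ := h
      have hvS' : v ∈ S' := by
        by_contra hv'
        refine hgv ?_
        rw [hT.K_eq hv]
        exact h' v hv'
      rw [T.eval_eq_zero_of_not_mem g hv hgv,
        (ofUnramified L N H S' T.loc T.arch).eval_eq_of_forall_mem g (by simpa only [ofUnramified_S] using h'), ofUnramified_S]
      refine mul_eq_zero_of_right _ (Finset.prod_eq_zero hvS' ?_)
      rw [hloc v]
      exact T.loc_apply_of_not_mem hv hgv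
  · push Not at h'
    obtain ⟨v, hv', hgv⟩ := h'
    have hv : v ∉ T.S := fun h => hv' (hS h)
    have hgv' : (cmDatum L N H).toLocal v g ∉ T.K v := by rwa [hT.K_eq hv]
    rw [(ofUnramified L N H S' T.loc T.arch).eval_eq_zero_of_not_mem g (by rwa [ofUnramified_S]) hgv, T.eval_eq_zero_of_not_mem g hv hgv']

/-- The re-presented tensor of a TEST tensor is a test tensor (same factors; ★ `isLocallyConstant_loc`, `hasCompactSupport_loc` give smoothness at EVERY finite place).
[cite: Rogawski1990, §14.2 p. 233] [cite: BorelJacquet1979, §4.1] -/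
theorem isTest_ofUnramified_of_isTest (T : PureTensor L N H) (hT : T.IsTest)
    (S' : Finset (HeightOneSpectrum (𝓞 ↥(maximalRealSubfield L)))) :
    (ofUnramified L N H S' T.loc T.arch).IsTest :=
  ⟨ofUnramified_isUnramified S' T.loc T.arch,
    ofUnramified_isFinSmooth T.arch fun v _ => ⟨isLocallyConstant_loc hT.isUnramified hT.isFinSmooth v, hasCompactSupport_loc hT.isUnramified hT.isFinSmooth v⟩,
    by obtain ⟨φ, hφc, hφs, hφa, hφT⟩ := hT.isArchTest; exact ⟨φ, hφc, hφs, hφa, hφT⟩⟩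

end Literature.NumberTheory.Automorphic.UnitaryGroup.PureTensor

namespace Summit.HodgeConjecture.HodgeConjecture.Cruxes.H413.F0P3SpectralPacket.SpectralPacketG

open Summit.HodgeConjecture.HodgeConjecture.Cruxes.H413.F0P3GlobalPacket

variable {L : Type} [Field L] [NumberField L] [IsCMField L]
  {𝔩 : ∀ v : HeightOneSpectrum (𝓞 ↥(maximalRealSubfield L)), LocalPacketKit L (splitForm L 3) v} {𝔞 : ArchPacketKit}
  {μ : Measure (adelicGroupData (↥(maximalRealSubfield L)) L (IsCMField.complexConj L) 3 (splitForm L 3)).automorphicQuotient}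
  [SMulInvariantMeasure (adelicGroupData (↥(maximalRealSubfield L)) L (IsCMField.complexConj L) 3 (splitForm L 3)).Adelic
    (adelicGroupData (↥(maximalRealSubfield L)) L (IsCMField.complexConj L) 3 (splitForm L 3)).automorphicQuotient μ]

/-! ## §1 The definitions [p. 201 first display, l. 1–4; §14.2 p. 233] -/

/-- **(d1) `Q.IsTestPresentation F T` — `T` PRESENTS `F` AS A SMOOTH PURE TENSOR AT THE INTEGRAL LEVELS WITH BAD SET `⊇ Π.ramFinset`**: `T.IsTest`, every level
`T.K v = U(Φ₃)(𝒪_v)` (`cmLocalIntegralLevel`), `Q.fin.ramFinset ⊆ T.S`, and `⇑F = T.eval` — exactly the four antecedents of ★ (TF-Π) `TraceOnPureTensors`.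
[cite: Rogawski1990, §14.2 p. 233; §13.3 p. 201 l. 1–4] -/
def IsTestPresentation (Q : SpectralPacketG 𝔩 𝔞 μ) (F : TestG L) (T : UnitaryGroup.PureTensor L 3 (splitForm L 3)) : Prop :=
  T.IsTest ∧ (∀ v : HeightOneSpectrum (𝓞 ↥(maximalRealSubfield L)), T.K v = cmLocalIntegralLevel L 3 (splitForm L 3) v) ∧
    Q.fin.ramFinset ⊆ T.S ∧ ⇑F = T.eval

/-- **(d2) `Q.trTensor νG archTr T := Tr Π_∞(T.arch) · ∏_{v ∈ T.S} Tr Π_v(T.loc v)`** — the packet trace of a PRESENTED pure tensor (★ FILE 1b `trPktInf` at the archimedean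
distribution character `archTr`, ★ FILE 1 `trPkt` at the local measures `νG`): print's `∏_v Tr Π_v(f_v)` cut at the bad set [p. 201 first display]. [cite: Rogawski1990, §13.3 p. 201; §13.7 p. 206] -/
def trTensor (Q : SpectralPacketG 𝔩 𝔞 μ)
    [∀ v : HeightOneSpectrum (𝓞 ↥(maximalRealSubfield L)), MeasurableSpace ((cmDatum L 3 (splitForm L 3)).Local v)]
    (νG : ∀ v : HeightOneSpectrum (𝓞 ↥(maximalRealSubfield L)), Measure ((cmDatum L 3 (splitForm L 3)).Local v))
    (archTr : GKIrrClass (uFormGroup (Fin 2) (Fin 1)) →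
      (UnitaryGroup.arch (↥(maximalRealSubfield L)) L (IsCMField.complexConj L) 3 (splitForm L 3) → ℂ) → ℂ)
    (T : UnitaryGroup.PureTensor L 3 (splitForm L 3)) : ℂ :=
  𝔞.trPktInf archTr Q.inf T.arch * ∏ v ∈ T.S, (𝔩 v).trPkt (νG v) (Q.fin.loc v) (T.loc v)

/-- **(d3) `Q.tr νG archTr : TestG L → ℂ` — THE PACKET TRACE `Tr Π(f)` AS A TOTAL FUNCTIONAL (the spectral tuple's `trG Q`)**: the product `trTensor` of SOME test
presentation of `F` when one exists (choice; independent of it under (TF-ind) `PresentationIndep`, `tr_eq_trTensor`), and `0` when `F` is not a smooth pure tensor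
presented at the integral levels — a value NO consumer reads (clause (T) of the spectral letter only meets matched `f` of a pinned kit, which are smooth pure tensors by pin
(ix′), `IsPinned.transfer_tensors`; §3 `tr_eq_of_isTest`). [cite: Rogawski1990, §13.3 p. 201; §14.2 p. 233; §14.6 (14.6.1) p. 241] -/
def tr (Q : SpectralPacketG 𝔩 𝔞 μ)
    [∀ v : HeightOneSpectrum (𝓞 ↥(maximalRealSubfield L)), MeasurableSpace ((cmDatum L 3 (splitForm L 3)).Local v)]
    (νG : ∀ v : HeightOneSpectrum (𝓞 ↥(maximalRealSubfield L)), Measure ((cmDatum L 3 (splitForm L 3)).Local v))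
    (archTr : GKIrrClass (uFormGroup (Fin 2) (Fin 1)) →
      (UnitaryGroup.arch (↥(maximalRealSubfield L)) L (IsCMField.complexConj L) 3 (splitForm L 3) → ℂ) → ℂ)
    (F : TestG L) : ℂ :=
  open scoped Classical in
  if h : ∃ T : UnitaryGroup.PureTensor L 3 (splitForm L 3), Q.IsTestPresentation F T then Q.trTensor νG archTr h.choose else 0

/-- **(d4) (TF-ind) `Q.PresentationIndep νG archTr` — «THE PRODUCT `∏_v Tr Π_v(f_v)` DOES NOT DEPEND ON THE PRESENTATION `f = ⊗ f_v`»**: two test presentations of one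
`F ∈ C_c(G(𝔸))` have the same `trTensor` (print p. 201 l. 1–4 treats this as part of «well-defined»; in-house: two presentations differ by place-wise scalars with product `1`
or share a zero factor, and admissible characters are homogeneous — the next brick). The ONE residual law of this file. [cite: Rogawski1990, §13.3 p. 201 l. 1–4]
[cite: FlathCorvallis1979, Thm. 3] -/
def PresentationIndep (Q : SpectralPacketG 𝔩 𝔞 μ)
    [∀ v : HeightOneSpectrum (𝓞 ↥(maximalRealSubfield L)), MeasurableSpace ((cmDatum L 3 (splitForm L 3)).Local v)]
    (νG : ∀ v : HeightOneSpectrum (𝓞 ↥(maximalRealSubfield L)), Measure ((cmDatum L 3 (splitForm L 3)).Local v))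
    (archTr : GKIrrClass (uFormGroup (Fin 2) (Fin 1)) →
      (UnitaryGroup.arch (↥(maximalRealSubfield L)) L (IsCMField.complexConj L) 3 (splitForm L 3) → ℂ) → ℂ) : Prop :=
  ∀ (F : TestG L) (T T' : UnitaryGroup.PureTensor L 3 (splitForm L 3)),
    Q.IsTestPresentation F T → Q.IsTestPresentation F T' → Q.trTensor νG archTr T = Q.trTensor νG archTr T'

/-! ## §2 Read-backs -/

variable {Q : SpectralPacketG 𝔩 𝔞 μ}

/-- Unfolding of (d1). [cite: Rogawski1990, §14.2 p. 233] -/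
theorem isTestPresentation_iff (F : TestG L) (T : UnitaryGroup.PureTensor L 3 (splitForm L 3)) :
    Q.IsTestPresentation F T ↔ T.IsTest ∧ (∀ v : HeightOneSpectrum (𝓞 ↥(maximalRealSubfield L)), T.K v = cmLocalIntegralLevel L 3 (splitForm L 3) v) ∧
      Q.fin.ramFinset ⊆ T.S ∧ ⇑F = T.eval :=
  Iff.rfl

/-! ### Every smooth pure tensor has a test presentation [§14.2 p. 233] -/

/-- **A smooth pure tensor `⇑F = T.eval` (`T.IsTest`, levels arbitrary on `T.S`) HAS a test presentation** with bad set `⊇ T.S`, the SAME archimedean factor and the SAME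
local factors (★ `PureTensor.ofUnramified` at `T.S ∪ Π.ramFinset`; `eval_ofUnramified_of_isUnramified`). [cite: Rogawski1990, §14.2 p. 233; §13.3 p. 201 l. 1–4] -/
theorem exists_isTestPresentation (Q : SpectralPacketG 𝔩 𝔞 μ) {F : TestG L} {T : UnitaryGroup.PureTensor L 3 (splitForm L 3)}
    (hT : T.IsTest) (hF : ⇑F = T.eval) :
    ∃ T' : UnitaryGroup.PureTensor L 3 (splitForm L 3), Q.IsTestPresentation F T' ∧ T.S ⊆ T'.S ∧ T'.arch = T.arch ∧
      ∀ v : HeightOneSpectrum (𝓞 ↥(maximalRealSubfield L)), T'.loc v = T.loc v := by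
  classical
  refine ⟨UnitaryGroup.PureTensor.ofUnramified L 3 (splitForm L 3) (T.S ∪ Q.fin.ramFinset) T.loc T.arch,
    ⟨T.isTest_ofUnramified_of_isTest hT _, fun _ => rfl, ?_, ?_⟩, ?_, rfl, fun v => ?_⟩
  · rw [UnitaryGroup.PureTensor.ofUnramified_S]
    exact Finset.subset_union_right
  · rw [hF, T.eval_ofUnramified_of_isUnramified hT.isUnramified _ Finset.subset_union_left]
  · rw [UnitaryGroup.PureTensor.ofUnramified_S]
    exact Finset.subset_union_left
  · by_cases hv : v ∈ T.S ∪ Q.fin.ramFinset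
    · exact UnitaryGroup.PureTensor.ofUnramified_loc_of_mem T.loc T.arch hv
    · rw [(UnitaryGroup.PureTensor.ofUnramified L 3 (splitForm L 3) (T.S ∪ Q.fin.ramFinset) T.loc T.arch).loc_eq_indicator v
          (by rwa [UnitaryGroup.PureTensor.ofUnramified_S]),
        T.loc_eq_indicator v (fun h => hv (Finset.mem_union_left _ h)), hT.isUnramified.K_eq (fun h => hv (Finset.mem_union_left _ h))]
      rfl

/-- The junk clause never fires at a smooth pure tensor: some test presentation exists. [cite: Rogawski1990, §14.2 p. 233] -/
theorem exists_isTestPresentation_of_isTest (Q : SpectralPacketG 𝔩 𝔞 μ) {F : TestG L} {T : UnitaryGroup.PureTensor L 3 (splitForm L 3)}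
    (hT : T.IsTest) (hF : ⇑F = T.eval) : ∃ T' : UnitaryGroup.PureTensor L 3 (splitForm L 3), Q.IsTestPresentation F T' :=
  (Q.exists_isTestPresentation hT hF).imp fun _ h => h.1


/-! ### The functional -/

variable [∀ v : HeightOneSpectrum (𝓞 ↥(maximalRealSubfield L)), MeasurableSpace ((cmDatum L 3 (splitForm L 3)).Local v)]
  {νG : ∀ v : HeightOneSpectrum (𝓞 ↥(maximalRealSubfield L)), Measure ((cmDatum L 3 (splitForm L 3)).Local v)}
  {archTr : GKIrrClass (uFormGroup (Fin 2) (Fin 1)) →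
    (UnitaryGroup.arch (↥(maximalRealSubfield L)) L (IsCMField.complexConj L) 3 (splitForm L 3) → ℂ) → ℂ}

/-- Unfolding of (d2). [cite: Rogawski1990, §13.3 p. 201] -/
theorem trTensor_eq (Q : SpectralPacketG 𝔩 𝔞 μ) (νG : ∀ v : HeightOneSpectrum (𝓞 ↥(maximalRealSubfield L)), Measure ((cmDatum L 3 (splitForm L 3)).Local v))
    (archTr : GKIrrClass (uFormGroup (Fin 2) (Fin 1)) →
      (UnitaryGroup.arch (↥(maximalRealSubfield L)) L (IsCMField.complexConj L) 3 (splitForm L 3) → ℂ) → ℂ)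
    (T : UnitaryGroup.PureTensor L 3 (splitForm L 3)) :
    Q.trTensor νG archTr T = 𝔞.trPktInf archTr Q.inf T.arch * ∏ v ∈ T.S, (𝔩 v).trPkt (νG v) (Q.fin.loc v) (T.loc v) :=
  rfl

/-- **The junk clause**: off the smooth pure tensors presented at the integral levels, `Tr Π(F) := 0`. [cite: Rogawski1990, §13.3 p. 201] -/
theorem tr_of_not {F : TestG L} (h : ¬ ∃ T : UnitaryGroup.PureTensor L 3 (splitForm L 3), Q.IsTestPresentation F T) :
    Q.tr νG archTr F = 0 := by
  rw [tr, dif_neg h]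

/-- **Under (TF-ind), `Tr Π(F)` is the product of ANY test presentation of `F`.** [cite: Rogawski1990, §13.3 p. 201 l. 1–4] -/
theorem tr_eq_trTensor (hind : Q.PresentationIndep νG archTr) {F : TestG L} {T : UnitaryGroup.PureTensor L 3 (splitForm L 3)}
    (hT : Q.IsTestPresentation F T) : Q.tr νG archTr F = Q.trTensor νG archTr T := by
  have h : ∃ T' : UnitaryGroup.PureTensor L 3 (splitForm L 3), Q.IsTestPresentation F T' := ⟨T, hT⟩
  rw [tr, dif_pos h]
  exact hind F _ _ h.choose_spec hT

/-- **★ FILE 2c's law (TF-Π) HOLDS for the defined functional** (modulo (TF-ind)): `Q.TraceOnPureTensors νG archTr (Q.tr νG archTr)`. [cite: Rogawski1990, §13.3 p. 201; §13.7 p. 206; §14.2 p. 233] -/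
theorem traceOnPureTensors_tr (hind : Q.PresentationIndep νG archTr) : Q.TraceOnPureTensors νG archTr (Q.tr νG archTr) :=
  fun _T hT hK hram _F hF => tr_eq_trTensor hind ⟨hT, hK, hram, hF⟩

/-- **The product over ANY larger finite set** (under (TF-ind) and ★ (TF-1) `UnramTraceOne`: the extra factors are `Tr Π_v(1_{K_v}) = 1`). [cite: Rogawski1990, §13.3 p. 201 l. 1–4] -/
theorem tr_eq_prod_of_subset (hind : Q.PresentationIndep νG archTr) (h1 : Q.fin.UnramTraceOne νG) {F : TestG L}
    {T : UnitaryGroup.PureTensor L 3 (splitForm L 3)} (hT : Q.IsTestPresentation F T)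
    (S' : Finset (HeightOneSpectrum (𝓞 ↥(maximalRealSubfield L)))) (hS' : T.S ⊆ S') :
    Q.tr νG archTr F = 𝔞.trPktInf archTr Q.inf T.arch * ∏ v ∈ S', (𝔩 v).trPkt (νG v) (Q.fin.loc v) (T.loc v) :=
  (traceOnPureTensors_tr hind).eq_prod_of_subset h1 T hT.1 hT.2.1 hT.2.2.1 F hT.2.2.2 S' hS'

/-! ## §3 `tr` is never junk at a matched `f` [§14.2 p. 233; (14.6.1)] -/

/-- **CONSUMER FORM — `Tr Π(f)` AT A SMOOTH PURE TENSOR IS THE PRODUCT, over any finite `S′ ⊇ T.S ∪ Π.ramFinset`** (under (TF-ind) and (TF-1)); with pin (ix′)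
`IsPinned.transfer_tensors` this is the value clause (T) of the spectral letter reads at every matched `f`. [cite: Rogawski1990, §13.3 p. 201; §14.2 p. 233; §14.6 (14.6.1) p. 241] -/
theorem tr_eq_of_isTest (hind : Q.PresentationIndep νG archTr) (h1 : Q.fin.UnramTraceOne νG) {F : TestG L}
    {T : UnitaryGroup.PureTensor L 3 (splitForm L 3)} (hT : T.IsTest) (hF : ⇑F = T.eval)
    (S' : Finset (HeightOneSpectrum (𝓞 ↥(maximalRealSubfield L)))) (hS : T.S ⊆ S') (hram : Q.fin.ramFinset ⊆ S') :
    Q.tr νG archTr F = 𝔞.trPktInf archTr Q.inf T.arch * ∏ v ∈ S', (𝔩 v).trPkt (νG v) (Q.fin.loc v) (T.loc v) := by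
  classical
  obtain ⟨T', hT', -, harch, hloc⟩ := Q.exists_isTestPresentation hT hF
  have ha : ∀ v ∈ T'.S ∪ S', v ∉ T'.S →
      T'.loc v = (cmLocalIntegralLevel L 3 (splitForm L 3) v : Set ((cmDatum L 3 (splitForm L 3)).Local v)).indicator fun _ => 1 := by
    intro v _ hv
    rw [T'.loc_eq_indicator v hv, hT'.2.1 v]
  have hb : ∀ v ∈ T'.S ∪ S', v ∉ S' →
      T.loc v = (cmLocalIntegralLevel L 3 (splitForm L 3) v : Set ((cmDatum L 3 (splitForm L 3)).Local v)).indicator fun _ => 1 := by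
    intro v _ hv
    rw [T.loc_eq_indicator v (fun h => hv (hS h)), hT.isUnramified.K_eq (fun h => hv (hS h))]
  rw [Q.tr_eq_trTensor hind hT', trTensor_eq, harch,
    ← Q.fin.prod_eq_prod_of_subset_of_unramTraceOne νG h1 T'.loc T'.S (T'.S ∪ S') Finset.subset_union_left hT'.2.2.1 ha,
    ← Q.fin.prod_eq_prod_of_subset_of_unramTraceOne νG h1 T.loc S' (T'.S ∪ S') Finset.subset_union_right hram hb]
  exact congrArg _ (Finset.prod_congr rfl fun v _ => by rw [hloc v])

end Summit.HodgeConjecture.HodgeConjecture.Cruxes.H413.F0P3SpectralPacket.SpectralPacketG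

end
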